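import Mathlib
import Summits.PneNP.PneNP.Theses.OneSlice
import Summits.PneNP.PneNP.Theorems.OneSliceSliceTargetSplit

/-!
# Route OneSlice, crux `MonotoneContinuation` (stmt-PneNP-18471), line `Sketch_ideator1_r1` (ProfileLine) — stub transportMono

Pointwise monotonicity of the slice transport in the slice index: for a MONOTONE Boolean `f` on the edge
cube of `K_n` and slices `j ≤ j' ≤ C(n,2)`, `T_j 𝟙[f](y) ≤ T_{j'} 𝟙[f](y)` at every edge vector `y`. Write
`s = e(y)`. The neighbourhoods `nbhd j y` are the weight-`j` vectors SQUEEZED between `∅` and `supp y`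
(`j ≤ s`) resp. between `supp y` and the full edge set (`s ≤ j`), i.e. sets of the form
`(slice n m).filter (U ⊆ supp · ⊆ V)`; both regimes `j ≤ j' ≤ s` and `s ≤ j ≤ j'` are one double counting of
the nested pairs `x ⊆ x'` between two such squeezed slices (a biregular coupling along which `𝟙[f]` is
non-decreasing: `…avg_le_avg_of_coupling`, `…avg_between_mono`), and the mixed regime `j ≤ s ≤ j'` chains the
two through `T_s 𝟙[f](y) = 𝟙[f](y)`.
-/

set_option linter.dupNamespace false -- `Summit.PneNP.PneNP.…`: summit = sub-problem (D-0017)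

namespace Summit.PneNP.PneNP.Theorems.MonotoneContinuation

open Literature.Computability.Complexity hiding supp mem_supp
open Finset hiding slice
open Filter hiding mem_sdiff
open Classical
open Summit.PneNP.PneNP.Theorems (binomialWeight_tail_le binomialWeight_sum_range binomialWeight_nonneg
  binomialWeight_variance card_slice)
open Summit.PneNP.PneNP.Theorems.ConstantBand.Negative (Edge thr Central slice)
open Summit.PneNP.PneNP.Theorems.SingleThreshold.Negative (pc)
open Summit.PneNP.PneNP.Theorems.SliceACZero.Negative (supp mem_supp card_supp supp_injective supp_indicator)
open Summit.PneNP.PneNP.Theorems.SliceTargetSplit (Comp nbhd mem_nbhd transport ind l1 nbhdCard card_nbhd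
  card_nbhd_of_le card_nbhd_of_ge choose_mul_nbhdCard nbhdCard_pos sum_slice_sum_nbhd sum_slice_sum_nbhd_left
  supp_subset_of_comp_of_le comp_iff_supp comp_comm ofSet supp_ofSet ofSet_supp edgeCount_ofSet ind_nonneg
  ind_le_one abs_ind_sub_ind l1_triangle l1_comm l1_nonneg transport_nonneg transport_sub)

noncomputable section

variable {n : ℕ}

/-! ### Averaging along a biregular monotone coupling -/

/-- **Averages along a biregular coupling.** If every `a ∈ A` is related to exactly `cA > 0` elements of `B`,
every `b ∈ B` to exactly `cB` elements of `A`, and `g a ≤ g b` along related pairs, then the average of `g` over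
the nonempty `A` is at most its average over the nonempty `B` (double counting: `#A·cA = #B·cB` pairs, and
`cA·Σ_A g = Σ_pairs g a ≤ Σ_pairs g b = cB·Σ_B g`). [folklore] -/
theorem stub_transportMono_avg_le_avg_of_coupling {α : Type*} {A B : Finset α} (R : α → α → Prop)
    [DecidableRel R] (g : α → ℝ) {cA cB : ℕ}
    (hA : ∀ a ∈ A, #(B.filter (R a ·)) = cA) (hB : ∀ b ∈ B, #(A.filter (R · b)) = cB)
    (hcA : 0 < cA) (hApos : 0 < #A) (hBpos : 0 < #B)
    (hmono : ∀ a ∈ A, ∀ b ∈ B, R a b → g a ≤ g b) :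
    (∑ a ∈ A, g a) / #A ≤ (∑ b ∈ B, g b) / #B := by
  -- the number of related pairs, counted from both sides
  have hP : #A * cA = #B * cB := card_mul_eq_card_mul R hA hB
  have hcB : 0 < cB := by
    rcases Nat.eq_zero_or_pos cB with h | h
    · rw [h, Nat.mul_zero] at hP
      exact absurd hP (Nat.mul_pos hApos hcA).ne'
    · exact h
  -- the coupling inequality
  have hsum : (cA : ℝ) * ∑ a ∈ A, g a ≤ (cB : ℝ) * ∑ b ∈ B, g b := by
    calc (cA : ℝ) * ∑ a ∈ A, g a = ∑ a ∈ A, ∑ _b ∈ B.filter (R a ·), g a := by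
          rw [mul_sum]
          refine sum_congr rfl fun a ha => ?_
          rw [sum_const, nsmul_eq_mul, ← hA a ha]
      _ ≤ ∑ a ∈ A, ∑ b ∈ B.filter (R a ·), g b :=
          sum_le_sum fun a ha => sum_le_sum fun b hb =>
            hmono a ha b (mem_filter.1 hb).1 (mem_filter.1 hb).2
      _ = ∑ b ∈ B, ∑ _a ∈ A.filter (R · b), g b := by
          simp_rw [sum_filter]
          exact sum_comm
      _ = (cB : ℝ) * ∑ b ∈ B, g b := by
          rw [mul_sum]
          refine sum_congr rfl fun b hb => ?_
          rw [sum_const, nsmul_eq_mul, ← hB b hb]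
  have hA' : (0 : ℝ) < #A := by exact_mod_cast hApos
  have hB' : (0 : ℝ) < #B := by exact_mod_cast hBpos
  have hcB' : (0 : ℝ) < cB := by exact_mod_cast hcB
  have hP' : (#A : ℝ) * cA = #B * cB := by exact_mod_cast hP
  rw [div_le_div_iff₀ hA' hB']
  refine le_of_mul_le_mul_right ?_ hcB'
  calc (∑ a ∈ A, g a) * #B * cB = (cA * ∑ a ∈ A, g a) * #A := by rw [mul_assoc, ← hP']; ring
    _ ≤ (cB * ∑ b ∈ B, g b) * #A := mul_le_mul_of_nonneg_right hsum hA'.le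
    _ = (∑ b ∈ B, g b) * #A * cB := by ring

/-! ### Squeezed slices: the weight-`m` vectors `w` with `U ⊆ supp w ⊆ V` -/

/-- Membership in a squeezed slice. [folklore] -/
theorem stub_transportMono_mem_between {U V : Finset (Edge n)} {m : ℕ} {w : Edge n → Bool} :
    w ∈ (slice n m).filter (fun w => U ⊆ supp w ∧ supp w ⊆ V) ↔ edgeCount w = m ∧ U ⊆ supp w ∧ supp w ⊆ V := by
  simp only [slice, mem_filter, mem_univ, true_and]

/-- **Size of a squeezed slice**: for `U ⊆ V` and `#U ≤ m` there are `C(#V - #U, m - #U)` weight-`m` vectors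
`w` with `U ⊆ supp w ⊆ V` (remove `U`: a bijection onto the `(m - #U)`-subsets of `V \ U`). [folklore] -/
theorem stub_transportMono_card_between {U V : Finset (Edge n)} (hUV : U ⊆ V) {m : ℕ} (hUm : #U ≤ m) :
    #((slice n m).filter fun w => U ⊆ supp w ∧ supp w ⊆ V) = (#V - #U).choose (m - #U) := by
  rw [← card_sdiff_of_subset hUV, ← card_powersetCard]
  refine card_nbij' (fun w => supp w \ U) (fun t => ofSet (U ∪ t)) ?_ ?_ ?_ ?_
  · intro w hw
    rw [mem_coe, stub_transportMono_mem_between] at hw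
    obtain ⟨hwm, hUw, hwV⟩ := hw
    rw [mem_coe, mem_powersetCard]
    refine ⟨sdiff_subset_sdiff hwV le_rfl, ?_⟩
    rw [card_sdiff_of_subset hUw, card_supp, hwm]
  · intro t ht
    rw [mem_coe, mem_powersetCard] at ht
    obtain ⟨htVU, htc⟩ := ht
    have hdisj : Disjoint U t := by
      rw [Finset.disjoint_left]
      intro e he het
      exact (mem_sdiff.1 (htVU het)).2 he
    rw [mem_coe, stub_transportMono_mem_between, edgeCount_ofSet, supp_ofSet]
    refine ⟨?_, subset_union_left, union_subset hUV (htVU.trans sdiff_subset)⟩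
    rw [card_union_of_disjoint hdisj, htc]
    omega
  · intro w hw
    rw [mem_coe, stub_transportMono_mem_between] at hw
    change ofSet (U ∪ (supp w \ U)) = w
    rw [union_sdiff_of_subset hw.2.1, ofSet_supp]
  · intro t ht
    rw [mem_coe, mem_powersetCard] at ht
    change supp (ofSet (U ∪ t)) \ U = t
    rw [supp_ofSet, union_sdiff_left, Finset.sdiff_eq_self_iff_disjoint, Finset.disjoint_left]
    intro e het he
    exact (mem_sdiff.1 (ht.1 het)).2 he

/-- Downward neighbourhoods are squeezed slices: for `j ≤ e(y)`, `nbhd j y` is the set of weight-`j` vectors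
`x` with `∅ ⊆ supp x ⊆ supp y`. [folklore] -/
theorem stub_transportMono_nbhd_eq_between_lower {j : ℕ} {y : Edge n → Bool} (hj : j ≤ edgeCount y) :
    nbhd j y = (slice n j).filter fun x => ∅ ⊆ supp x ∧ supp x ⊆ supp y := by
  ext x
  rw [mem_nbhd, stub_transportMono_mem_between]
  constructor
  · rintro ⟨hxj, hc⟩
    exact ⟨hxj, empty_subset _, supp_subset_of_comp_of_le hc (hxj ▸ hj)⟩
  · rintro ⟨hxj, -, hxy⟩
    exact ⟨hxj, comp_iff_supp.2 (Or.inl hxy)⟩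

/-- Upward neighbourhoods are squeezed slices: for `e(y) ≤ j`, `nbhd j y` is the set of weight-`j` vectors
`x` with `supp y ⊆ supp x ⊆ univ`. [folklore] -/
theorem stub_transportMono_nbhd_eq_between_upper {j : ℕ} {y : Edge n → Bool} (hj : edgeCount y ≤ j) :
    nbhd j y = (slice n j).filter fun x => supp y ⊆ supp x ∧ supp x ⊆ univ := by
  ext x
  rw [mem_nbhd, stub_transportMono_mem_between]
  constructor
  · rintro ⟨hxj, hc⟩
    exact ⟨hxj, supp_subset_of_comp_of_le (comp_comm.1 hc) (hxj ▸ hj), subset_univ _⟩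
  · rintro ⟨hxj, hyx, -⟩
    exact ⟨hxj, comp_iff_supp.2 (Or.inr hyx)⟩

/-- The vectors of a squeezed slice above a given `x` (with `U ⊆ supp x`) form the squeezed slice between
`supp x` and `V`. [folklore] -/
theorem stub_transportMono_between_filter_supset {U V : Finset (Edge n)} {m : ℕ} {x : Edge n → Bool}
    (hUx : U ⊆ supp x) :
    ((slice n m).filter fun w => U ⊆ supp w ∧ supp w ⊆ V).filter (fun w => supp x ⊆ supp w) =
      (slice n m).filter fun w => supp x ⊆ supp w ∧ supp w ⊆ V := by
  ext w
  simp only [mem_filter]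
  constructor
  · rintro ⟨⟨hwm, -, hwV⟩, hxw⟩
    exact ⟨hwm, hxw, hwV⟩
  · rintro ⟨hwm, hxw, hwV⟩
    exact ⟨⟨hwm, hUx.trans hxw, hwV⟩, hxw⟩

/-- The vectors of a squeezed slice below a given `x'` (with `supp x' ⊆ V`) form the squeezed slice between
`U` and `supp x'`. [folklore] -/
theorem stub_transportMono_between_filter_subset {U V : Finset (Edge n)} {m : ℕ} {x' : Edge n → Bool}
    (hxV : supp x' ⊆ V) :
    ((slice n m).filter fun w => U ⊆ supp w ∧ supp w ⊆ V).filter (fun w => supp w ⊆ supp x') =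
      (slice n m).filter fun w => U ⊆ supp w ∧ supp w ⊆ supp x' := by
  ext w
  simp only [mem_filter]
  constructor
  · rintro ⟨⟨hwm, hUw, -⟩, hwx⟩
    exact ⟨hwm, hUw, hwx⟩
  · rintro ⟨hwm, hUw, hwx⟩
    exact ⟨⟨hwm, hUw, hwx.trans hxV⟩, hwx⟩

/-- **Monotonicity of squeezed-slice averages.** For `U ⊆ V`, `#U ≤ j ≤ j' ≤ #V` and `g` non-decreasing along
inclusion of supports, the average of `g` over the weight-`j` vectors squeezed between `U` and `V` is at most its
average over the weight-`j'` ones: couple `x ⊆ x'`; each `x` lies below `C(#V - j, j' - j)` such `x'`, each `x'`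
above `C(j' - #U, j - #U)` such `x`. [folklore] -/
theorem stub_transportMono_avg_between_mono {U V : Finset (Edge n)} (hUV : U ⊆ V) {j j' : ℕ} (hUj : #U ≤ j)
    (hjj' : j ≤ j') (hj'V : j' ≤ #V) {g : (Edge n → Bool) → ℝ}
    (hg : ∀ x x' : Edge n → Bool, supp x ⊆ supp x' → g x ≤ g x') :
    (∑ x ∈ (slice n j).filter (fun w => U ⊆ supp w ∧ supp w ⊆ V), g x) /
        #((slice n j).filter fun w => U ⊆ supp w ∧ supp w ⊆ V) ≤
      (∑ x ∈ (slice n j').filter (fun w => U ⊆ supp w ∧ supp w ⊆ V), g x) /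
        #((slice n j').filter fun w => U ⊆ supp w ∧ supp w ⊆ V) := by
  refine stub_transportMono_avg_le_avg_of_coupling (fun x x' => supp x ⊆ supp x') g
    (cA := (#V - j).choose (j' - j)) (cB := (j' - #U).choose (j - #U)) ?_ ?_
    (Nat.choose_pos (by omega)) ?_ ?_ (fun x _ x' _ h => hg x x' h)
  · intro x hx
    obtain ⟨hxj, hUx, hxV⟩ := stub_transportMono_mem_between.1 hx
    rw [stub_transportMono_between_filter_supset hUx,
      stub_transportMono_card_between hxV (by rw [card_supp, hxj]; exact hjj'), card_supp, hxj]
  · intro x' hx'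
    obtain ⟨hx'j, hUx', hx'V⟩ := stub_transportMono_mem_between.1 hx'
    rw [stub_transportMono_between_filter_subset hx'V, stub_transportMono_card_between hUx' hUj, card_supp,
      hx'j]
  · rw [stub_transportMono_card_between hUV hUj]
    exact Nat.choose_pos (by omega)
  · rw [stub_transportMono_card_between hUV (hUj.trans hjj')]
    exact Nat.choose_pos (by omega)

/-! ### The stub -/

/-- The indicator of a monotone Boolean function is non-decreasing along inclusion of supports. [folklore] -/
theorem stub_transportMono_ind_mono {f : (Edge n → Bool) → Bool} (hf : Monotone f) (x x' : Edge n → Bool)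
    (h : supp x ⊆ supp x') : ind f x ≤ ind f x' := by
  have hfx : f x ≤ f x' := hf (Summit.PneNP.PneNP.Theorems.SliceTargetSplit.le_of_supp_subset h)
  unfold ind
  by_cases h1 : f x = true
  · have h2 : f x' = true := by
      rw [h1] at hfx
      exact top_le_iff.1 hfx
    rw [if_pos h1, if_pos h2]
  · rw [if_neg h1]
    split_ifs <;> norm_num

/-- **Lower regime** `j ≤ j' ≤ e(y)`: both transports average over subsets of `supp y`. [folklore] -/
theorem stub_transportMono_lower {f : (Edge n → Bool) → Bool} (hf : Monotone f) {j j' : ℕ} (hjj' : j ≤ j')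
    {y : Edge n → Bool} (hj' : j' ≤ edgeCount y) : transport j (ind f) y ≤ transport j' (ind f) y := by
  unfold transport
  rw [stub_transportMono_nbhd_eq_between_lower (hjj'.trans hj'), stub_transportMono_nbhd_eq_between_lower hj']
  exact stub_transportMono_avg_between_mono (empty_subset _) (by rw [card_empty]; exact Nat.zero_le _) hjj'
    (by rwa [card_supp]) (stub_transportMono_ind_mono hf)

/-- **Upper regime** `e(y) ≤ j ≤ j' ≤ C(n,2)`: both transports average over supersets of `supp y`. [folklore] -/
theorem stub_transportMono_upper {f : (Edge n → Bool) → Bool} (hf : Monotone f) {j j' : ℕ} {y : Edge n → Bool}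
    (hj : edgeCount y ≤ j) (hjj' : j ≤ j') (hj'N : j' ≤ n.choose 2) :
    transport j (ind f) y ≤ transport j' (ind f) y := by
  unfold transport
  rw [stub_transportMono_nbhd_eq_between_upper hj, stub_transportMono_nbhd_eq_between_upper (hj.trans hjj')]
  exact stub_transportMono_avg_between_mono (subset_univ _) (by rwa [card_supp]) hjj'
    (by rwa [card_univ, card_edgeSet_top_fin]) (stub_transportMono_ind_mono hf)

/-- **Pointwise monotonicity of the transport in the slice index** (stub `transportMono` of the line
`Sketch_ideator1_r1`): for a monotone Boolean `f` on the edge cube of `K_n`, slices `j ≤ j' ≤ C(n,2)` and every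
edge vector `y`, `T_j 𝟙[f](y) ≤ T_{j'} 𝟙[f](y)`. Three regimes in `s = e(y)`: `j' ≤ s` (lower), `s ≤ j` (upper),
and `j ≤ s ≤ j'`, where `T_j 𝟙[f](y) ≤ T_s 𝟙[f](y) = 𝟙[f](y) ≤ T_{j'} 𝟙[f](y)` chains the two. [folklore] -/
theorem stub_transportMono :
  ∀ (n j j' : ℕ) (f : (Edge n → Bool) → Bool), Monotone f → j ≤ j' → j' ≤ n.choose 2 →
    ∀ y : Edge n → Bool, transport j (ind f) y ≤ transport j' (ind f) y := by
  intro n j j' f hf hjj' hj'N y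
  rcases le_total j' (edgeCount y) with h1 | h1
  · exact stub_transportMono_lower hf hjj' h1
  rcases le_total (edgeCount y) j with h2 | h2
  · exact stub_transportMono_upper hf h2 hjj' hj'N
  · exact (stub_transportMono_lower hf h2 le_rfl).trans (stub_transportMono_upper hf le_rfl h1 hj'N)

end

end Summit.PneNP.PneNP.Theorems.MonotoneContinuation
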